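/-
COR-CM (cell pub-hodgecm2, stage 2 of the Hodge ladder) — Δ2 BRIDGE, pin «J3» (ASSEMBLER DECISIONS #3/#4, HOME/INBOX l.10797, l.10813):
the FAITHFULNESS leg `hfaith` of the proof's record at the pin (`Map43RationalData.P_injective` via prove-2's `PΩ_injective (hfaith) (htr)`):
«pulling back along the component Albanese morphisms detects non-zero homomorphisms on `H¹`».  GENERIC CORE, hole-free: for a family of
complex varieties `Y_c` with Albanese data `𝒥_c` whose Abel–Jacobi pull-backs are injective on `H¹(−;ℚ)` ([Liu2021] Lem. 2.4 (1) — at the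
model's components `Model.isIso_bettiCohomology_map_abelJacobi_pms` (as in `HcmS3AlbaneseBetti`), at ball-uniformised pieces
`UnitaryBallUniformisationDatum.isIso_bettiCohomology_map_abelJacobi`) and homomorphisms `ι_c : J(Y_c) → A` that are JOINTLY EPIMORPHIC
(the tree theorem `Albanese.exists_jacobian_hom_baseChange_of_ne_zero` for `A = Alb_{X_K} ⊗_{E} ℂ`), every non-zero `w : A → B` has a
non-zero pull-back `(f^{P_c} ≫ ι_c ≫ w)^*` on `H¹(B(ℂ); ℚ)` for some `c`; plus the upgrade of an injective additive map on a Hom-group to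
its `ℚ`-linear extension on `ℚ ⊗_ℤ Hom` (the currency `Hom_E(A_K, A_μ)_ℚ` of Thm. 4.18 (1)).  Seat prover-pub-hodgecm2-d2bridge-prove-3-g0-0.
THEOREMS ONLY; no `sorry`.  HC_CM is NOT proved; nothing here is a display or a pointer move.
-/
import Summits.HodgeConjecture.CorCM.Geometry.AlbaneseRangeBallQuotient
import Literature.AlgebraicGeometry.Motives.JacobianBasePoint
import Literature.AlgebraicGeometry.ComplexMultiplication.EndAlgebraCommSubalgebraDegreeBound
import HarnessLib

/-!
# Δ2 bridge, pin J3: Abel–Jacobi pull-backs along a jointly epimorphic family detect non-zero homomorphisms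

* `exists_pull_abelJacobi_comp_ne_zero` — generic: `Y_c` complex varieties with Albanese data `𝒥_c` and points `P_c` such that
  `(f^{P_c})^*` is injective on `H¹(J(Y_c)(ℂ); ℚ)`; `ι_c : J(Y_c) ⟶ A` jointly epimorphic (every non-zero `w` out of `A` has some
  `ι_c ≫ w ≠ 0`); then every non-zero `w : A ⟶ B` has SOME `c` with `(f^{P_c} ≫ ι_c ≫ w)^* ≠ 0` on `H¹(B(ℂ); ℚ) → H¹(Y_c(ℂ); ℚ)`
  (faithfulness of the rational representation, `hom_eq_zero_of_bettiCohomology_map_one_eq_zero`, and `pull_comp`);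
* `exists_pull_abelJacobi_comp_ne_zero_of_isIso` — the same with the hypothesis in the `IsIso (bettiCohomology.map (f^P) 1)` currency of
  `UnitaryBallUniformisationDatum.isIso_bettiCohomology_map_abelJacobi` ∕ `Model.isIso_bettiCohomology_map_abelJacobi_pms`;
* `exists_pull_abelJacobi_comp_ne_zero_pms` — at the model's components `P_{c} = Var.scheme hU h₃ (.pms (code c))` (anisotropic codes), the
  injectivity being [Liu2021] Lem. 2.4 (1) BY NAME (`Model.isIso_bettiCohomology_map_abelJacobi_pms`);
* `TensorProduct.exists_inv_natCast_tmul` — every element of `ℚ ⊗_ℤ M` is `N⁻¹ ⊗ m`; `injective_of_tmul_eq_smul` — a `ℚ`-linear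
  `Φ : ℚ ⊗_ℤ M → V` with `Φ (q ⊗ m) = q • φ m` is injective as soon as the additive `φ` is (the `hfaith` upgrade from `Hom_E(A_K, A_μ)` to
  `Hom_E(A_K, A_μ)_ℚ = ℚ ⊗_ℤ Hom`).

All folklore; everything proved. [folklore]
-/

noncomputable section

open scoped TensorProduct
open CategoryTheory Function
open Literature.AlgebraicGeometry.Motives
open Literature.AlgebraicGeometry.HodgeTheory
open Literature.NumberTheory.Automorphic.PicardCM

namespace Summit.HodgeConjecture.CorCM.D2Bridge

/-! ## The detection lemma -/

/-- **Abel–Jacobi pull-backs along a jointly epimorphic family detect non-zero homomorphisms.**  If `(f^{P_c})^*` is injective on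
`H¹(J(Y_c)(ℂ); ℚ)` for every `c` and the `ι_c : J(Y_c) ⟶ A` are jointly epimorphic, then for every non-zero `w : A ⟶ B` some
`(f^{P_c} ≫ ι_c ≫ w)^* : H¹(B(ℂ); ℚ) → H¹(Y_c(ℂ); ℚ)` is non-zero (the rational representation of complex abelian varieties is faithful).
[folklore] -/
theorem exists_pull_abelJacobi_comp_ne_zero {κ : Type*} {Y : κ → SchemeOver ℂ} (𝒥 : ∀ c, Jacobian (Y c))
    (P : ∀ c, AlgPoints (Y c) ℂ) (hinj : ∀ c, Injective (BettiUniverse.pull ((𝒥 c).abelJacobi (P c)) 1))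
    {A : AbelianVariety ℂ} (ι : ∀ c, (𝒥 c).J ⟶ A)
    (hepi : ∀ (B : AbelianVariety ℂ) (w : A ⟶ B), w ≠ 0 → ∃ c, ι c ≫ w ≠ 0)
    {B : AbelianVariety ℂ} (w : A ⟶ B) (hw : w ≠ 0) :
    ∃ c, BettiUniverse.pull ((𝒥 c).abelJacobi (P c) ≫ (ι c ≫ w).hom.hom.hom) 1 ≠ 0 := by
  obtain ⟨c, hc⟩ := hepi B w hw
  refine ⟨c, fun h0 => hc ?_⟩
  apply Literature.AlgebraicGeometry.ComplexMultiplication.hom_eq_zero_of_bettiCohomology_map_one_eq_zero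
  apply LinearMap.ext
  intro x
  apply hinj c
  have hx := LinearMap.congr_fun h0 x
  rw [BettiUniverse.pull_comp, LinearMap.comp_apply, LinearMap.zero_apply] at hx
  rw [LinearMap.zero_apply, map_zero]
  exact hx

/-- The same with the Lemma-2.4-(1) hypothesis in the `IsIso` currency (as produced by
`UnitaryBallUniformisationDatum.isIso_bettiCohomology_map_abelJacobi` for ball-uniformised pieces and by
`Model.isIso_bettiCohomology_map_abelJacobi_pms` for the model's components). [folklore] -/
theorem exists_pull_abelJacobi_comp_ne_zero_of_isIso {κ : Type*} {Y : κ → SchemeOver ℂ} (𝒥 : ∀ c, Jacobian (Y c))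
    (P : ∀ c, AlgPoints (Y c) ℂ) (hiso : ∀ c, IsIso (bettiCohomology.map ((𝒥 c).abelJacobi (P c)) 1))
    {A : AbelianVariety ℂ} (ι : ∀ c, (𝒥 c).J ⟶ A)
    (hepi : ∀ (B : AbelianVariety ℂ) (w : A ⟶ B), w ≠ 0 → ∃ c, ι c ≫ w ≠ 0)
    {B : AbelianVariety ℂ} (w : A ⟶ B) (hw : w ≠ 0) :
    ∃ c, BettiUniverse.pull ((𝒥 c).abelJacobi (P c) ≫ (ι c ≫ w).hom.hom.hom) 1 ≠ 0 :=
  exists_pull_abelJacobi_comp_ne_zero 𝒥 P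
    (fun c => haveI := hiso c; (asIso (bettiCohomology.map ((𝒥 c).abelJacobi (P c)) 1)).toLinearEquiv.injective) ι hepi w hw

/-- **At the model's components** `P_{c} = Var.scheme hU h₃ (.pms (code c))` (anisotropic codes; any Albanese data and base points):
the detection lemma with [Liu2021] Lem. 2.4 (1) BY NAME (`Model.isIso_bettiCohomology_map_abelJacobi_pms`).  This is the shape of the `hfaith` leg at the
pin once the J2 pieces are identified with the model's surfaces. [cite: Liu2021, Lemma 2.4 (1) (FJcycle.tex l. 1213)] -/
theorem exists_pull_abelJacobi_comp_ne_zero_pms {hU : BallQuotientUniformisedDatum} {h₃ : CMAbelianVarietyRealised}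
    {κ : Type*} (code : κ → PicardCode) (han : ∀ c, (code c).IsAnisotropic)
    (𝒥 : ∀ c, Jacobian (Var.scheme hU h₃ (.pms (code c)))) (P : ∀ c, AlgPoints (Var.scheme hU h₃ (.pms (code c))) ℂ)
    {A : AbelianVariety ℂ} (ι : ∀ c, (𝒥 c).J ⟶ A)
    (hepi : ∀ (B : AbelianVariety ℂ) (w : A ⟶ B), w ≠ 0 → ∃ c, ι c ≫ w ≠ 0)
    {B : AbelianVariety ℂ} (w : A ⟶ B) (hw : w ≠ 0) :
    ∃ c, BettiUniverse.pull ((𝒥 c).abelJacobi (P c) ≫ (ι c ≫ w).hom.hom.hom) 1 ≠ 0 :=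
  exists_pull_abelJacobi_comp_ne_zero_of_isIso 𝒥 P
    (fun c => Model.isIso_bettiCohomology_map_abelJacobi_pms (code c) (han c) (𝒥 c) (P c)) ι hepi w hw

/-- Pointwise form of the detection: a non-zero `w` has some `c` and some class `x ∈ H¹(B(ℂ); ℚ)` with `(f^{P_c} ≫ ι_c ≫ w)^* x ≠ 0`.
[folklore] -/
theorem exists_pull_abelJacobi_comp_apply_ne_zero {κ : Type*} {Y : κ → SchemeOver ℂ} (𝒥 : ∀ c, Jacobian (Y c))
    (P : ∀ c, AlgPoints (Y c) ℂ) (hinj : ∀ c, Injective (BettiUniverse.pull ((𝒥 c).abelJacobi (P c)) 1))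
    {A : AbelianVariety ℂ} (ι : ∀ c, (𝒥 c).J ⟶ A)
    (hepi : ∀ (B : AbelianVariety ℂ) (w : A ⟶ B), w ≠ 0 → ∃ c, ι c ≫ w ≠ 0)
    {B : AbelianVariety ℂ} (w : A ⟶ B) (hw : w ≠ 0) :
    ∃ c, ∃ x : bettiCohomology B.X 1, BettiUniverse.pull ((𝒥 c).abelJacobi (P c) ≫ (ι c ≫ w).hom.hom.hom) 1 x ≠ 0 := by
  obtain ⟨c, hc⟩ := exists_pull_abelJacobi_comp_ne_zero 𝒥 P hinj ι hepi w hw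
  refine ⟨c, ?_⟩
  by_contra hall
  apply hc
  apply LinearMap.ext
  intro x
  rw [LinearMap.zero_apply]
  by_contra hx
  exact hall ⟨x, hx⟩

/-! ## From `Hom` to `ℚ ⊗_ℤ Hom` -/

/-- **Every element of `ℚ ⊗_ℤ M` is `N⁻¹ ⊗ m`** for some positive integer `N` and `m ∈ M` (common denominators). [folklore] -/
theorem TensorProduct.exists_inv_natCast_tmul {M : Type*} [AddCommGroup M] (t : ℚ ⊗[ℤ] M) :
    ∃ (N : ℕ) (_ : 0 < N) (m : M), t = ((N : ℚ)⁻¹) ⊗ₜ[ℤ] m := by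
  induction t using TensorProduct.induction_on with
  | zero => exact ⟨1, one_pos, 0, by rw [TensorProduct.tmul_zero]⟩
  | tmul q m =>
    refine ⟨q.den, q.den_pos, q.num • m, ?_⟩
    rw [← TensorProduct.smul_tmul, zsmul_eq_mul, ← div_eq_mul_inv, Rat.num_div_den]
  | add s t hs ht =>
    obtain ⟨N₁, hN₁, m₁, rfl⟩ := hs
    obtain ⟨N₂, hN₂, m₂, rfl⟩ := ht
    refine ⟨N₁ * N₂, Nat.mul_pos hN₁ hN₂, (N₂ : ℤ) • m₁ + (N₁ : ℤ) • m₂, ?_⟩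
    have h1 : (N₁ : ℚ) ≠ 0 := Nat.cast_ne_zero.mpr hN₁.ne'
    have h2 : (N₂ : ℚ) ≠ 0 := Nat.cast_ne_zero.mpr hN₂.ne'
    rw [TensorProduct.tmul_add, ← TensorProduct.smul_tmul, ← TensorProduct.smul_tmul, zsmul_eq_mul, zsmul_eq_mul,
      Int.cast_natCast, Int.cast_natCast, Nat.cast_mul]
    congr 2
    · field_simp
    · field_simp

/-- **An additive map out of `M` that is injective stays injective after `ℚ`-linear extension to `ℚ ⊗_ℤ M`** — for any `ℚ`-linear
`Φ : ℚ ⊗_ℤ M → V` with `Φ (q ⊗ m) = q • φ m` (e.g. `φ.toIntLinearMap.liftBaseChange ℚ`): the currency `Hom_E(A_K, A_μ)_ℚ = ℚ ⊗_ℤ Hom` of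
[Liu2021] Thm. 4.18 (1) versus the Hom-group itself.  No torsion hypothesis is needed. [folklore] -/
theorem injective_of_tmul_eq_smul {M : Type*} [AddCommGroup M] {V : Type*} [AddCommGroup V] [Module ℚ V]
    (φ : M →+ V) (hφ : Injective φ) (Φ : ℚ ⊗[ℤ] M →ₗ[ℚ] V) (hΦ : ∀ (q : ℚ) (m : M), Φ (q ⊗ₜ[ℤ] m) = q • φ m) :
    Injective Φ := by
  rw [injective_iff_map_eq_zero]
  intro t ht
  obtain ⟨N, hN, m, rfl⟩ := TensorProduct.exists_inv_natCast_tmul t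
  have hN' : (N : ℚ) ≠ 0 := Nat.cast_ne_zero.mpr hN.ne'
  rw [hΦ] at ht
  have hm : φ m = 0 := by
    have := congrArg (fun v => (N : ℚ) • v) ht
    simpa only [smul_smul, mul_inv_cancel₀ hN', one_smul, smul_zero] using this
  rw [(injective_iff_map_eq_zero φ).1 hφ m hm, TensorProduct.tmul_zero]

end Summit.HodgeConjecture.CorCM.D2Bridge

end
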